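import Summits.AtomisticToContinuum.Crystallization.Theses.SymmetryRankLadder

/-!
# Birth skeleton — crux `SymmetryRankLadder.TransverseCompactness`

Item `stmt-AtomisticToContinuum-5831` (crux, rank 2, route `SymmetryRankLadder`, sub-problem
`Crystallization`; piece X₁ of the BC2-redirect decomposition of the deciding crux
`HcpPeriodicMinimiser`, stmt-AtomisticToContinuum-3061, assembly
`Cruxes/HcpPeriodicMinimiser/SplitAssembly.lean`).

The crux (C2, "two short imposed periods and a hard core suffice"): every periodic configuration
`Q` of `ℝ³` is matched, at no higher Lennard-Jones energy per particle, by a periodic `Q'` whose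
distinct points are `≥ 1/2` apart and whose period lattice contains two linearly independent vectors
of length `≤ 6/5`.

First cut — THE LADDER ONE RUNG FINER (three named stubs). The route's mechanism is the filtration by
the rank of imposed translation symmetry; the crux is its rank-2 rung in the periodic shadow. The cut
isolates the hard-core cleaning (rank 0, a stability statement) and then climbs rank 0 → 1 → 2:

* `stub_hardCoreCleaning` — every periodic `Q` is matched at no higher energy per particle by a
  periodic `Q'` with hard core `1/2`. TRUE under the expected picture (`Q' =` relaxed hcp qualifies:
  `le_dist_of_mem_barlowStacking`, min(a, h) ≥ 0.733) and provable WITHOUT it (size M–L): if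
  `e(Q) ≥ e(P₀)` for the fixed hard-core witness `P₀ = hcp(1, 4/5)` take `Q' = P₀`; otherwise
  `e(Q) < e(P₀) < 0` and orbit surgery applies — delete the orbit of a point with a neighbour closer
  than `1/2`: its site energy is `≥ V(1/2) − C = 330.7 − C` with `C` the (lattice-uniform) bound on the
  attractive part of a hard-core-free site sum controlled through `e(Q) < 0` (the orbit-deletion
  identity `e′ = (|F| e − S_x)/(|F| − 1)`, cf. `PeriodicReductionToBarlow/STRATEGY-CENSUS.md` §D3), and
  iterate on the finite motif. Leans on: `PeriodicConfiguration.energyPerParticle`,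
  `neg_one_div_le_lennardJones`, `bddBelow`-type lattice-sum bounds (PeriodicConfigurationSums.lean).
* `stub_oneShortPeriod` — RUNG 1 (periodic shadow): every hard-core periodic `Q` is matched, at no
  higher energy per particle, by a hard-core periodic `Q'` whose period lattice contains ONE non-zero
  vector of length `≤ 6/5`. Strictly weaker than the crux in form (one period, not two); true under
  the expected picture; the minimiser-free content is "a short period can be imposed for free" — the
  first rung of the ladder, where the competitor class is rods `y + ℤu` (card: rung 1, R₁). Size XL
  (open); why it might fail: a large-cell phase with all periods `> 6/5` below every short-period
  configuration (σ/A15-type; floats say +1–3 %).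
* `stub_secondShortPeriod` — RUNG 2 GIVEN RUNG 1: every hard-core periodic `Q` that already has one
  period of length `≤ 6/5` is matched by a hard-core periodic `Q'` with TWO linearly independent
  periods of length `≤ 6/5`. Weaker hypothesis class than the crux (one short period is given), so
  not the crux reworded; the content is the second step of the ladder (in the quotient `ℝ³/ℤu` the
  problem is a 2-D-periodic problem for decorated rods, and a second short period is to be imposed at
  no cost). Size XL (open); why it might fail: in-layer/rod superstructure (period doubling along the
  second direction) could be energetically preferred at bounded first period.

Assembly `TransverseCompactness_of` (real proof, no `sorry`): clean `Q ↦ Q₁` (stub 1), impose one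
short period `Q₁ ↦ Q₂` (stub 2), impose the second `Q₂ ↦ Q₃` (stub 3), chain the three energy
inequalities; concludes the route decl `SymmetryRankLadder.TransverseCompactness` BY NAME.
`TransverseCompactness_proof` instantiates it with the three stubs (sorries: exactly the stubs).
Neither stub is the crux or the sub-problem `Crystallization` reworded: stub 1 drops the period
clause, stub 2 asks one period and assumes a hard core, stub 3 assumes a short period (BC3 probes,
`Cruxes/HcpPeriodicMinimiser/BC2-REDIRECT.md`). Disproof used: none on file for 5831 or 3061
(`ledger crux ls`: no `Disproof.lean`); negatives index (`ledger negatives --problem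
AtomisticToContinuum`): no refuted statement is an instance of a stub (none of them concerns period
lengths or hard cores of periodic competitors).
-/

namespace Summit.AtomisticToContinuum.Crystallization.Cruxes.TransverseCompactness.Birth

/-- **Stub 1 — hard-core cleaning.** Every periodic configuration of `ℝ³` is matched, at no higher
Lennard-Jones energy per particle, by a periodic configuration whose distinct points are at mutual
distance `≥ 1/2`. True (expected picture: relaxed hcp; minimiser-free: threshold witness `hcp(1,4/5)`
for `e(Q) ≥ e(P₀)`, orbit surgery below it); size M–L. Strictly weaker than the crux (no period
clause). -/
theorem stub_hardCoreCleaning : ∀ Q : Literature.MathematicalPhysics.StatisticalMechanics.PeriodicConfiguration 3, ∃ Q' : Literature.MathematicalPhysics.StatisticalMechanics.PeriodicConfiguration 3, Q'.energyPerParticle Literature.MathematicalPhysics.StatisticalMechanics.lennardJones ≤ Q.energyPerParticle Literature.MathematicalPhysics.StatisticalMechanics.lennardJones ∧ (∀ x ∈ Q'.points, ∀ y ∈ Q'.points, x ≠ y → (1 / 2 : ℝ) ≤ dist x y) := by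
  sorry

/-- **Stub 2 — rung 1: one short period for free.** Every hard-core periodic configuration is
matched, at no higher energy per particle, by a hard-core periodic configuration whose period
lattice contains a non-zero vector of length `≤ 6/5`. Open (XL); strictly weaker than the crux in
form. -/
theorem stub_oneShortPeriod : ∀ Q : Literature.MathematicalPhysics.StatisticalMechanics.PeriodicConfiguration 3, (∀ x ∈ Q.points, ∀ y ∈ Q.points, x ≠ y → (1 / 2 : ℝ) ≤ dist x y) → ∃ Q' : Literature.MathematicalPhysics.StatisticalMechanics.PeriodicConfiguration 3, Q'.energyPerParticle Literature.MathematicalPhysics.StatisticalMechanics.lennardJones ≤ Q.energyPerParticle Literature.MathematicalPhysics.StatisticalMechanics.lennardJones ∧ (∀ x ∈ Q'.points, ∀ y ∈ Q'.points, x ≠ y → (1 / 2 : ℝ) ≤ dist x y) ∧ (∃ u ∈ Q'.lattice, u ≠ 0 ∧ ‖u‖ ≤ 6 / 5) := by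
  sorry

/-- **Stub 3 — rung 2 given rung 1: the second short period.** Every hard-core periodic
configuration with one period of length `≤ 6/5` is matched, at no higher energy per particle, by a
hard-core periodic configuration with two linearly independent periods of length `≤ 6/5`. Open (XL);
weaker hypothesis class than the crux. -/
theorem stub_secondShortPeriod : ∀ Q : Literature.MathematicalPhysics.StatisticalMechanics.PeriodicConfiguration 3, (∀ x ∈ Q.points, ∀ y ∈ Q.points, x ≠ y → (1 / 2 : ℝ) ≤ dist x y) → (∃ u ∈ Q.lattice, u ≠ 0 ∧ ‖u‖ ≤ 6 / 5) → ∃ Q' : Literature.MathematicalPhysics.StatisticalMechanics.PeriodicConfiguration 3, Q'.energyPerParticle Literature.MathematicalPhysics.StatisticalMechanics.lennardJones ≤ Q.energyPerParticle Literature.MathematicalPhysics.StatisticalMechanics.lennardJones ∧ (∀ x ∈ Q'.points, ∀ y ∈ Q'.points, x ≠ y → (1 / 2 : ℝ) ≤ dist x y) ∧ (∃ u ∈ Q'.lattice, ∃ v ∈ Q'.lattice, LinearIndependent ℝ ![u, v] ∧ ‖u‖ ≤ 6 / 5 ∧ ‖v‖ ≤ 6 / 5) := by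
  sorry

/-- **Assembly**: stub 1 → stub 2 → stub 3 → the crux (clean, impose one period, impose the
second, chain the energies). Concludes `SymmetryRankLadder.TransverseCompactness` by name; no
`sorry`. -/
theorem TransverseCompactness_of : (∀ Q : Literature.MathematicalPhysics.StatisticalMechanics.PeriodicConfiguration 3, ∃ Q' : Literature.MathematicalPhysics.StatisticalMechanics.PeriodicConfiguration 3, Q'.energyPerParticle Literature.MathematicalPhysics.StatisticalMechanics.lennardJones ≤ Q.energyPerParticle Literature.MathematicalPhysics.StatisticalMechanics.lennardJones ∧ (∀ x ∈ Q'.points, ∀ y ∈ Q'.points, x ≠ y → (1 / 2 : ℝ) ≤ dist x y)) → (∀ Q : Literature.MathematicalPhysics.StatisticalMechanics.PeriodicConfiguration 3, (∀ x ∈ Q.points, ∀ y ∈ Q.points, x ≠ y → (1 / 2 : ℝ) ≤ dist x y) → ∃ Q' : Literature.MathematicalPhysics.StatisticalMechanics.PeriodicConfiguration 3, Q'.energyPerParticle Literature.MathematicalPhysics.StatisticalMechanics.lennardJones ≤ Q.energyPerParticle Literature.MathematicalPhysics.StatisticalMechanics.lennardJones ∧ (∀ x ∈ Q'.points, ∀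 y ∈ Q'.points, x ≠ y → (1 / 2 : ℝ) ≤ dist x y) ∧ (∃ u ∈ Q'.lattice, u ≠ 0 ∧ ‖u‖ ≤ 6 / 5)) → (∀ Q : Literature.MathematicalPhysics.StatisticalMechanics.PeriodicConfiguration 3, (∀ x ∈ Q.points, ∀ y ∈ Q.points, x ≠ y → (1 / 2 : ℝ) ≤ dist x y) → (∃ u ∈ Q.lattice, u ≠ 0 ∧ ‖u‖ ≤ 6 / 5) → ∃ Q' : Literature.MathematicalPhysics.StatisticalMechanics.PeriodicConfiguration 3, Q'.energyPerParticle Literature.MathematicalPhysics.StatisticalMechanics.lennardJones ≤ Q.energyPerParticle Literature.MathematicalPhysics.StatisticalMechanics.lennardJones ∧ (∀ x ∈ Q'.points, ∀ y ∈ Q'.points, x ≠ y → (1 / 2 : ℝ) ≤ dist x y) ∧ (∃ u ∈ Q'.lattice, ∃ v ∈ Q'.lattice, LinearIndependent ℝ ![u, v] ∧ ‖u‖ ≤ 6 / 5 ∧ ‖v‖ ≤ 6 / 5)) → Summit.AtomisticToContinuum.Crystallization.Theses.SymmetryRankLadder.TransverseCompactness := by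
  intro h₁ h₂ h₃ Q
  obtain ⟨Q₁, hQ₁, hc₁⟩ := h₁ Q
  obtain ⟨Q₂, hQ₂, hc₂, ho₂⟩ := h₂ Q₁ hc₁
  obtain ⟨Q₃, hQ₃, hc₃, hp₃⟩ := h₃ Q₂ hc₂ ho₂
  exact ⟨Q₃, (hQ₃.trans hQ₂).trans hQ₁, hc₃, hp₃⟩

/-- The crux modulo exactly the three stubs. -/
theorem TransverseCompactness_proof : Summit.AtomisticToContinuum.Crystallization.Theses.SymmetryRankLadder.TransverseCompactness :=
  TransverseCompactness_of stub_hardCoreCleaning stub_oneShortPeriod stub_secondShortPeriod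

end Summit.AtomisticToContinuum.Crystallization.Cruxes.TransverseCompactness.Birth
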